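import Literature.Barriers.CriticalPhenomena.RigorousRGSmallParameterKChangeOfVariables
import HarnessLib

/-!
# `RigorousRGSmallParameter` (Slade, Theorem 1.4.1): Brydges' change of variables, II —
# `K_out` factorises over components and is field-local (`K_out ∈ 𝒦`)

Companion ("proof architecture") file of
`Literature/Barriers/CriticalPhenomena/RigorousRGSmallParameter.lean`, continuing
`RigorousRGSmallParameterKChangeOfVariables.lean` ([BS-rg-step] §4.1 / appendix "Change of
variables", arXiv:1403.7256 §11): "The properties that define `𝒴(W)`, together with the
hypothesis that `K_in ∈ 𝒦` and that `J` obeys (4.3) [field locality in its `B` argument], can be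
used to verify the claim that `K_out ∈ 𝒦`. In particular, `K_out` obeys the factorisation property
of Definition [`𝒦_j`] by construction, and the field locality property holds because we have
constructed `K_out(W)` as a polynomial in the local objects `J̄`, `M`, `I_in` evaluated on sets
contained in `W`." Here (Slade, Definition 6.1.2) the factorisation property is
`K(X) = ∏_{Y ∈ Comp_j(X)} K(Y)` and field locality is `K(X) ∈ 𝒩(X^□)`.

This file PROVES both claims for the explicit `kout` of the companion file:

* **`kout_union`**: `K_out(W₁ ∪ W₂) = K_out(W₁) K_out(W₂)` for non-touching polymers — the index
  set `𝒴(W₁ ∪ W₂)` is the product `𝒴(W₁) × 𝒴(W₂)` (restriction `cvRestrict` / merging `cvMerge`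
  are inverse bijections: a connected set inside a non-touching union lies in one piece,
  `IsConn.subset_or_subset`; `X^□` of the restriction is computed by `sclosure_subset_left`) and
  the summand is multiplicative (`cvTerm_mul_blockProd_cvMerge`); hence
  **`kout_biUnion_of_isGas`** and **`kout_eq_prod_components`** (`K_out(W) = ∏_{Comp(W)} K_out`).
* **`dependsOn_kout`**: if `I(B) ∈ 𝒩(B^□)`, `J(U,B) ∈ 𝒩(B^□)` on `𝒟(J)` (and `J = 0` off `𝒟(J)`),
  and `K_in(Y) ∈ 𝒩(Y^□)` for connected polymers `Y`, then `K_out(W) ∈ 𝒩(W^□)` for every polymer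
  `W` (values in the function algebra `(Λ → V) → S`).

(The symmetry properties of `𝒦_j` — Euclidean covariance, `O(n)` invariance — "do not play an
explicit role" (Slade, after Definition 6.1.2) and are not treated here.)

Sources: D. C. Brydges, G. Slade, J. Stat. Phys. 159 (2015) 589–667, arXiv:1403.7256, appendix
"Change of variables" (paragraph after the formula for `K_out`); G. Slade, arXiv:1611.06169,
Definition 6.1.2.

## References

* [BrydgesSlade2015RGV] D. C. Brydges, G. Slade, *A renormalisation group method. V. A single
  renormalisation group step*, J. Stat. Phys. **159** (2015) 589–667, arXiv:1403.7256.
* [Slade2017] G. Slade, *Critical exponents for long-range O(n) models below the upper critical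
  dimension*, Commun. Math. Phys. **358** (2018) 343–436, arXiv:1611.06169.
-/

noncomputable section

open Finset

namespace Literature.Barriers.CriticalPhenomena

namespace LongRangePhi4

namespace Polymer

open Literature.Probability.LatticeModels

variable {d M : ℕ} [NeZero M]

section ChangeOfVariablesFactorisation

variable {R : Type*} [CommRing R] (b : ℕ) (I : Finset (TorusSite d M) → R) (K : Finset (TorusSite d M) → R)
  (J : Finset (TorusSite d M) → Finset (TorusSite d M) → R)


/-! ### Component factorisation of `K_out` -/

omit [NeZero M] in
/-- A connected set inside the union of two non-touching sets which meets the first lies in the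
first. [folklore] -/
theorem IsConn.subset_of_inter_nonempty {Y W₁ W₂ : Finset (TorusSite d M)} (hY : IsConn Y) (hsub : Y ⊆ W₁ ∪ W₂)
    (h12 : ¬ Touch W₁ W₂) (hne : (Y ∩ W₁).Nonempty) : Y ⊆ W₁ := by
  obtain ⟨x, hx⟩ := hne
  rw [mem_inter] at hx
  intro z hz
  have hc := hY.2 x hx.1 z hz
  clear hz
  unfold ConnIn at hc
  induction hc with
  | refl => exact hx.2
  | @tail w z' _ hwz ih =>
    obtain ⟨-, hz'Y, hadj⟩ := hwz
    rcases mem_union.1 (hsub hz'Y) with h | h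
    · exact h
    · exact absurd ⟨w, ih, z', h, Or.inr hadj⟩ h12

omit [NeZero M] in
/-- A connected set inside the union of two non-touching sets lies in one of them. [folklore] -/
theorem IsConn.subset_or_subset {Y W₁ W₂ : Finset (TorusSite d M)} (hY : IsConn Y) (hsub : Y ⊆ W₁ ∪ W₂)
    (h12 : ¬ Touch W₁ W₂) : Y ⊆ W₁ ∨ Y ⊆ W₂ := by
  classical
  by_cases hne : (Y ∩ W₁).Nonempty
  · exact Or.inl (hY.subset_of_inter_nonempty hsub h12 hne)
  · right
    intro z hz
    rcases mem_union.1 (hsub hz) with h | h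
    · exact absurd ⟨z, mem_inter.2 ⟨hz, h⟩⟩ hne
    · exact h

/-- `T ⊆ W₁`, `T^□ ⊆ W₁ ∪ W₂` with `W₁, W₂` non-touching force `T^□ ⊆ W₁`. [folklore] -/
theorem sclosure_subset_left {T W₁ W₂ : Finset (TorusSite d M)} (hT : T ⊆ W₁) (hsub : sclosure b T ⊆ W₁ ∪ W₂)
    (h12 : ¬ Touch W₁ W₂) : sclosure b T ⊆ W₁ := by
  intro y hy
  obtain ⟨Y, hY, ⟨z, hz⟩, hyY⟩ := mem_sclosure.1 hy
  have hYsub : Y ⊆ sclosure b T := fun w hw => mem_sclosure.2 ⟨Y, hY, ⟨z, hz⟩, hw⟩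
  rw [mem_inter] at hz
  exact hY.2.1.subset_of_inter_nonempty (hYsub.trans hsub) h12 ⟨z, mem_inter.2 ⟨hz.2, hT hz.1⟩⟩ hyY

/-- Restriction of an index `(S, 𝒱)` to the pieces inside `Z`. [folklore] -/
def cvRestrict (Z : Finset (TorusSite d M))
    (q : Finset (Finset (TorusSite d M) × Finset (TorusSite d M)) × Finset (Finset (TorusSite d M))) :
    Finset (Finset (TorusSite d M) × Finset (TorusSite d M)) × Finset (Finset (TorusSite d M)) :=
  (q.1.filter fun p => p.1 ⊆ Z, q.2.filter fun V => V ⊆ Z)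

/-- Merging two indices. [folklore] -/
def cvMerge (q₁ q₂ : Finset (Finset (TorusSite d M) × Finset (TorusSite d M)) × Finset (Finset (TorusSite d M))) :
    Finset (Finset (TorusSite d M) × Finset (TorusSite d M)) × Finset (Finset (TorusSite d M)) :=
  (q₁.1 ∪ q₂.1, q₁.2 ∪ q₂.2)

variable {b}

/-- For an admissible index, each `U_B` lies in `W(S, 𝒱)`. [folklore] -/
theorem CvAdm.fst_subset_cvW {S : Finset (Finset (TorusSite d M) × Finset (TorusSite d M))}
    {𝒱 : Finset (Finset (TorusSite d M))} (h : CvAdm b S 𝒱) {p : Finset (TorusSite d M) × Finset (TorusSite d M)}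
    (hp : p ∈ S) : p.1 ⊆ cvW b (S, 𝒱) := by
  classical
  refine Subset.trans (fun y hy => ?_) h.cvSupp_subset_cvW
  exact mem_union_left _ (mem_biUnion.2 ⟨p, hp, hy⟩)

/-- For an admissible index, each `V ∈ 𝒱` lies in `W(S, 𝒱)`. [folklore] -/
theorem CvAdm.subset_cvW_of_mem {S : Finset (Finset (TorusSite d M) × Finset (TorusSite d M))}
    {𝒱 : Finset (Finset (TorusSite d M))} (h : CvAdm b S 𝒱) {V : Finset (TorusSite d M)} (hV : V ∈ 𝒱) :
    V ⊆ cvW b (S, 𝒱) := by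
  classical
  refine Subset.trans (fun y hy => ?_) h.cvSupp_subset_cvW
  exact mem_union_right _ (mem_biUnion.2 ⟨V, hV, hy⟩)

/-- Restriction preserves admissibility. [folklore] -/
theorem CvAdm.restrict {S : Finset (Finset (TorusSite d M) × Finset (TorusSite d M))}
    {𝒱 : Finset (Finset (TorusSite d M))} (h : CvAdm b S 𝒱) (Z : Finset (TorusSite d M)) :
    CvAdm b (cvRestrict Z (S, 𝒱)).1 (cvRestrict Z (S, 𝒱)).2 := by
  unfold cvRestrict
  refine ⟨(filter_subset _ _).trans h.1, (filter_subset _ _).trans h.2.1, ?_, ?_, ?_⟩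
  · intro p hp q hq hne
    exact h.2.2.1 p (mem_filter.1 hp).1 q (mem_filter.1 hq).1 hne
  · intro V hV V' hV' hne
    exact h.2.2.2.1 V (mem_filter.1 hV).1 V' (mem_filter.1 hV').1 hne
  · intro p hp V hV
    exact h.2.2.2.2 p (mem_filter.1 hp).1 V (mem_filter.1 hV).1

section Split

variable {W₁ W₂ : Finset (TorusSite d M)} (h12 : ¬ Touch W₁ W₂)
include h12

/-- In `𝒴(W₁ ∪ W₂)` (non-touching pieces), every `U_B` lies in `W₁` or in `W₂`. [folklore] -/
theorem fst_subset_or_of_mem_cvFiber_union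
    {q : Finset (Finset (TorusSite d M) × Finset (TorusSite d M)) × Finset (Finset (TorusSite d M))}
    (hq : q ∈ cvFiber b (W₁ ∪ W₂)) {p : Finset (TorusSite d M) × Finset (TorusSite d M)} (hp : p ∈ q.1) :
    p.1 ⊆ W₁ ∨ p.1 ⊆ W₂ := by
  obtain ⟨hadm, hW⟩ := mem_cvFiber.1 hq
  have := hadm.fst_subset_cvW hp
  rw [show (q.1, q.2) = q from rfl, hW] at this
  exact (isPolymer_isConn_of_mem_djSet (hadm.1 hp)).2.subset_or_subset this h12

/-- In `𝒴(W₁ ∪ W₂)` (non-touching pieces), every `V ∈ 𝒱` lies in `W₁` or in `W₂`. [folklore] -/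
theorem subset_or_of_mem_cvFiber_union
    {q : Finset (Finset (TorusSite d M) × Finset (TorusSite d M)) × Finset (Finset (TorusSite d M))}
    (hq : q ∈ cvFiber b (W₁ ∪ W₂)) {V : Finset (TorusSite d M)} (hV : V ∈ q.2) : V ⊆ W₁ ∨ V ⊆ W₂ := by
  obtain ⟨hadm, hW⟩ := mem_cvFiber.1 hq
  have := hadm.subset_cvW_of_mem hV
  rw [show (q.1, q.2) = q from rfl, hW] at this
  exact (mem_connSet.1 (hadm.2.1 hV)).2.subset_or_subset this h12

/-- **Restriction to a piece lands in that piece's `𝒴`**: for `q ∈ 𝒴(W₁ ∪ W₂)`,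
`q|_{W₁} ∈ 𝒴(W₁)`. [folklore] -/
theorem cvRestrict_mem_cvFiber
    {q : Finset (Finset (TorusSite d M) × Finset (TorusSite d M)) × Finset (Finset (TorusSite d M))}
    (hq : q ∈ cvFiber b (W₁ ∪ W₂)) : cvRestrict W₁ q ∈ cvFiber b W₁ := by
  classical
  obtain ⟨hadm, hW⟩ := mem_cvFiber.1 hq
  rcases q with ⟨S, 𝒱⟩
  refine mem_cvFiber.2 ⟨hadm.restrict W₁, ?_⟩
  have hdisj : Disjoint W₁ W₂ := disjoint_of_not_touch h12
  apply Subset.antisymm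
  · -- `⊆ W₁`
    apply union_subset
    · refine sclosure_subset_left b (fun y hy => ?_) ?_ h12
      · obtain ⟨p, hp, hyp⟩ := mem_biUnion.1 hy
        obtain ⟨hpS, hpW⟩ := mem_filter.1 hp
        exact hpW (subset_of_mem_blocksOf (mem_djSet.1 (hadm.1 hpS)).1.1 (mem_djSet.1 (hadm.1 hpS)).2 hyp)
      · have h1 : sclosure b (xOf S) ⊆ W₁ ∪ W₂ := by
          rw [← hW]
          exact subset_union_left
        refine Subset.trans (sclosure_mono b fun y hy => ?_) h1
        obtain ⟨p, hp, hyp⟩ := mem_biUnion.1 hy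
        exact mem_biUnion.2 ⟨p, (mem_filter.1 hp).1, hyp⟩
    · intro y hy
      obtain ⟨V, hV, hyV⟩ := mem_biUnion.1 hy
      exact (mem_filter.1 hV).2 hyV
  · -- `W₁ ⊆`
    intro x hx
    have hxW : x ∈ cvW b (S, 𝒱) := hW ▸ mem_union_left _ hx
    rcases mem_union.1 hxW with h | h
    · obtain ⟨Y, hY, ⟨z, hz⟩, hxY⟩ := mem_sclosure.1 h
      rw [mem_inter] at hz
      obtain ⟨p, hp, hzp⟩ := mem_biUnion.1 hz.1
      -- `Y ⊆ W₁ ∪ W₂`, connected, contains `x ∈ W₁`, hence `Y ⊆ W₁`; so `z ∈ W₁` and `p.1 ⊆ W₁`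
      have hYsub : Y ⊆ W₁ ∪ W₂ := by
        refine Subset.trans (fun w hw => mem_sclosure.2 ⟨Y, hY, ⟨z, mem_inter.2 ⟨hz.1, hz.2⟩⟩, hw⟩) ?_
        exact hW ▸ subset_union_left
      have hYW₁ : Y ⊆ W₁ := hY.2.1.subset_of_inter_nonempty hYsub h12 ⟨x, mem_inter.2 ⟨hxY, hx⟩⟩
      have hp1 : p.1 ⊆ W₁ := by
        rcases fst_subset_or_of_mem_cvFiber_union h12 hq hp with h1 | h2
        · exact h1
        · exfalso
          have hzW₂ : z ∈ W₂ := h2 (subset_of_mem_blocksOf (mem_djSet.1 (hadm.1 hp)).1.1 (mem_djSet.1 (hadm.1 hp)).2 hzp)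
          exact disjoint_left.1 hdisj (hYW₁ hz.2) hzW₂
      refine mem_union_left _ (mem_sclosure.2 ⟨Y, hY, ⟨z, mem_inter.2 ⟨?_, hz.2⟩⟩, hxY⟩)
      exact mem_biUnion.2 ⟨p, mem_filter.2 ⟨hp, hp1⟩, hzp⟩
    · obtain ⟨V, hV, hxV⟩ := mem_biUnion.1 h
      have hV1 : V ⊆ W₁ := by
        rcases subset_or_of_mem_cvFiber_union h12 hq hV with h1 | h2
        · exact h1
        · exact absurd (h2 hxV) (disjoint_left.1 hdisj hx)
      exact mem_union_right _ (mem_biUnion.2 ⟨V, mem_filter.2 ⟨hV, hV1⟩, hxV⟩)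

/-- Merging the two restrictions recovers the index. [folklore] -/
theorem cvMerge_cvRestrict
    {q : Finset (Finset (TorusSite d M) × Finset (TorusSite d M)) × Finset (Finset (TorusSite d M))}
    (hq : q ∈ cvFiber b (W₁ ∪ W₂)) : cvMerge (cvRestrict W₁ q) (cvRestrict W₂ q) = q := by
  unfold cvMerge cvRestrict
  rcases q with ⟨S, 𝒱⟩
  simp only [Prod.mk.injEq]
  constructor
  · rw [Finset.filter_union_right]
    refine Finset.filter_true_of_mem fun p hp => ?_
    exact fst_subset_or_of_mem_cvFiber_union h12 hq hp
  · rw [Finset.filter_union_right]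
    refine Finset.filter_true_of_mem fun V hV => ?_
    exact subset_or_of_mem_cvFiber_union h12 hq hV

omit [NeZero M] in
/-- A nonempty subset of `W₂` is not a subset of `W₁`. [folklore] -/
theorem not_subset_left_of_subset_right {Y : Finset (TorusSite d M)} (hne : Y.Nonempty) (h2 : Y ⊆ W₂) : ¬ Y ⊆ W₁ := by
  intro h1
  obtain ⟨y, hy⟩ := hne
  exact h12 ⟨y, h1 hy, y, h2 hy, Or.inl rfl⟩

/-- **Merging indices of the two pieces gives an index of the union.** [folklore] -/
theorem cvMerge_mem_cvFiber
    {q₁ q₂ : Finset (Finset (TorusSite d M) × Finset (TorusSite d M)) × Finset (Finset (TorusSite d M))}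
    (hq₁ : q₁ ∈ cvFiber b W₁) (hq₂ : q₂ ∈ cvFiber b W₂) : cvMerge q₁ q₂ ∈ cvFiber b (W₁ ∪ W₂) := by
  classical
  obtain ⟨h₁, hW₁'⟩ := mem_cvFiber.1 hq₁
  obtain ⟨h₂, hW₂'⟩ := mem_cvFiber.1 hq₂
  rcases q₁ with ⟨S₁, 𝒱₁⟩
  rcases q₂ with ⟨S₂, 𝒱₂⟩
  have hS₁W : ∀ p ∈ S₁, p.1 ⊆ W₁ := fun p hp => hW₁' ▸ h₁.fst_subset_cvW hp
  have hS₂W : ∀ p ∈ S₂, p.1 ⊆ W₂ := fun p hp => hW₂' ▸ h₂.fst_subset_cvW hp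
  have h𝒱₁W : ∀ V ∈ 𝒱₁, V ⊆ W₁ := fun V hV => hW₁' ▸ h₁.subset_cvW_of_mem hV
  have h𝒱₂W : ∀ V ∈ 𝒱₂, V ⊆ W₂ := fun V hV => hW₂' ▸ h₂.subset_cvW_of_mem hV
  have hnt : ∀ {A B : Finset (TorusSite d M)}, A ⊆ W₁ → B ⊆ W₂ → ¬ Touch A B :=
    fun hA hB ht => h12 (ht.mono hA hB)
  refine mem_cvFiber.2 ⟨⟨?_, ?_, ?_, ?_, ?_⟩, ?_⟩
  · exact union_subset h₁.1 h₂.1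
  · exact union_subset h₁.2.1 h₂.2.1
  · intro p hp q hq hne
    rcases mem_union.1 hp with hp | hp <;> rcases mem_union.1 hq with hq | hq
    · exact h₁.2.2.1 p hp q hq hne
    · exact hnt (hS₁W p hp) (hS₂W q hq)
    · exact fun ht => hnt (hS₁W q hq) (hS₂W p hp) ht.symm
    · exact h₂.2.2.1 p hp q hq hne
  · intro V hV V' hV' hne
    rcases mem_union.1 hV with hV | hV <;> rcases mem_union.1 hV' with hV' | hV'
    · exact h₁.2.2.2.1 V hV V' hV' hne
    · exact hnt (h𝒱₁W V hV) (h𝒱₂W V' hV')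
    · exact fun ht => hnt (h𝒱₁W V' hV') (h𝒱₂W V hV) ht.symm
    · exact h₂.2.2.2.1 V hV V' hV' hne
  · intro p hp V hV
    rcases mem_union.1 hp with hp | hp <;> rcases mem_union.1 hV with hV | hV
    · exact h₁.2.2.2.2 p hp V hV
    · exact hnt (hS₁W p hp) (h𝒱₂W V hV)
    · exact fun ht => hnt (h𝒱₁W V hV) (hS₂W p hp) ht.symm
    · exact h₂.2.2.2.2 p hp V hV
  · show cvW b (S₁ ∪ S₂, 𝒱₁ ∪ 𝒱₂) = W₁ ∪ W₂
    rw [← hW₁', ← hW₂']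
    simp only [cvW, xOf, Finset.union_biUnion, sclosure_union]
    exact Finset.union_union_union_comm _ _ _ _

/-- Restricting a merged index to the first piece. [folklore] -/
theorem cvRestrict_cvMerge_left
    {q₁ q₂ : Finset (Finset (TorusSite d M) × Finset (TorusSite d M)) × Finset (Finset (TorusSite d M))}
    (hq₁ : q₁ ∈ cvFiber b W₁) (hq₂ : q₂ ∈ cvFiber b W₂) : cvRestrict W₁ (cvMerge q₁ q₂) = q₁ := by
  obtain ⟨h₁, hW₁'⟩ := mem_cvFiber.1 hq₁
  obtain ⟨h₂, hW₂'⟩ := mem_cvFiber.1 hq₂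
  rcases q₁ with ⟨S₁, 𝒱₁⟩
  rcases q₂ with ⟨S₂, 𝒱₂⟩
  unfold cvRestrict cvMerge
  simp only [Finset.filter_union, Prod.mk.injEq]
  constructor
  · rw [Finset.filter_true_of_mem fun p hp => hW₁' ▸ h₁.fst_subset_cvW hp,
      Finset.filter_false_of_mem fun p hp => ?_, union_empty]
    exact not_subset_left_of_subset_right h12 (h₂.fst_nonempty hp) (hW₂' ▸ h₂.fst_subset_cvW hp)
  · rw [Finset.filter_true_of_mem fun V hV => hW₁' ▸ h₁.subset_cvW_of_mem hV,
      Finset.filter_false_of_mem fun V hV => ?_, union_empty]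
    exact not_subset_left_of_subset_right h12 (mem_connSet.1 (h₂.2.1 hV)).2.1 (hW₂' ▸ h₂.subset_cvW_of_mem hV)

/-- Restricting a merged index to the second piece. [folklore] -/
theorem cvRestrict_cvMerge_right
    {q₁ q₂ : Finset (Finset (TorusSite d M) × Finset (TorusSite d M)) × Finset (Finset (TorusSite d M))}
    (hq₁ : q₁ ∈ cvFiber b W₁) (hq₂ : q₂ ∈ cvFiber b W₂) : cvRestrict W₂ (cvMerge q₁ q₂) = q₂ := by
  obtain ⟨h₁, hW₁'⟩ := mem_cvFiber.1 hq₁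
  obtain ⟨h₂, hW₂'⟩ := mem_cvFiber.1 hq₂
  rcases q₁ with ⟨S₁, 𝒱₁⟩
  rcases q₂ with ⟨S₂, 𝒱₂⟩
  have h21 : ¬ Touch W₂ W₁ := fun h => h12 h.symm
  unfold cvRestrict cvMerge
  simp only [Finset.filter_union, Prod.mk.injEq]
  constructor
  · rw [Finset.filter_true_of_mem (s := S₂) fun p hp => hW₂' ▸ h₂.fst_subset_cvW hp,
      Finset.filter_false_of_mem (s := S₁) fun p hp => ?_, empty_union]
    exact not_subset_left_of_subset_right h21 (h₁.fst_nonempty hp) (hW₁' ▸ h₁.fst_subset_cvW hp)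
  · rw [Finset.filter_true_of_mem (s := 𝒱₂) fun V hV => hW₂' ▸ h₂.subset_cvW_of_mem hV,
      Finset.filter_false_of_mem (s := 𝒱₁) fun V hV => ?_, empty_union]
    exact not_subset_left_of_subset_right h21 (mem_connSet.1 (h₁.2.1 hV)).2.1 (hW₁' ▸ h₁.subset_cvW_of_mem hV)

/-- **Multiplicativity of the summand under merging.** [folklore] -/
theorem cvTerm_mul_blockProd_cvMerge (hW₁ : IsPolymer b W₁) (hW₂ : IsPolymer b W₂)
    {q₁ q₂ : Finset (Finset (TorusSite d M) × Finset (TorusSite d M)) × Finset (Finset (TorusSite d M))}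
    (hq₁ : q₁ ∈ cvFiber b W₁) (hq₂ : q₂ ∈ cvFiber b W₂) :
    cvTerm b I K J (cvMerge q₁ q₂) * blockProd b I ((W₁ ∪ W₂) \ cvSupp (cvMerge q₁ q₂)) =
      (cvTerm b I K J q₁ * blockProd b I (W₁ \ cvSupp q₁)) * (cvTerm b I K J q₂ * blockProd b I (W₂ \ cvSupp q₂)) := by
  classical
  obtain ⟨h₁, hW₁'⟩ := mem_cvFiber.1 hq₁
  obtain ⟨h₂, hW₂'⟩ := mem_cvFiber.1 hq₂
  rcases q₁ with ⟨S₁, 𝒱₁⟩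
  rcases q₂ with ⟨S₂, 𝒱₂⟩
  have hdisj : Disjoint W₁ W₂ := disjoint_of_not_touch h12
  have hA₁ : cvSupp (S₁, 𝒱₁) ⊆ W₁ := hW₁' ▸ h₁.cvSupp_subset_cvW
  have hA₂ : cvSupp (S₂, 𝒱₂) ⊆ W₂ := hW₂' ▸ h₂.cvSupp_subset_cvW
  -- disjointness of the index families
  have hdS : Disjoint S₁ S₂ := by
    rw [Finset.disjoint_left]
    intro p hp₁ hp₂
    exact not_subset_left_of_subset_right h12 (h₂.fst_nonempty hp₂) (hW₂' ▸ h₂.fst_subset_cvW hp₂)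
      (hW₁' ▸ h₁.fst_subset_cvW hp₁)
  have hd𝒱 : Disjoint 𝒱₁ 𝒱₂ := by
    rw [Finset.disjoint_left]
    intro V hV₁ hV₂
    exact not_subset_left_of_subset_right h12 (mem_connSet.1 (h₂.2.1 hV₂)).2.1 (hW₂' ▸ h₂.subset_cvW_of_mem hV₂)
      (hW₁' ▸ h₁.subset_cvW_of_mem hV₁)
  -- the background splits
  have hsupp : cvSupp (cvMerge (S₁, 𝒱₁) (S₂, 𝒱₂)) = cvSupp (S₁, 𝒱₁) ∪ cvSupp (S₂, 𝒱₂) := by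
    simp only [cvSupp, cvMerge, ujOf, Finset.union_biUnion]
    exact Finset.union_union_union_comm _ _ _ _
  have hset : (W₁ ∪ W₂) \ cvSupp (cvMerge (S₁, 𝒱₁) (S₂, 𝒱₂)) = (W₁ \ cvSupp (S₁, 𝒱₁)) ∪ (W₂ \ cvSupp (S₂, 𝒱₂)) := by
    rw [hsupp]
    ext x
    simp only [mem_sdiff, mem_union, not_or]
    constructor
    · rintro ⟨hx | hx, hn₁, hn₂⟩
      · exact Or.inl ⟨hx, hn₁⟩
      · exact Or.inr ⟨hx, hn₂⟩
    · rintro (⟨hx, hn⟩ | ⟨hx, hn⟩)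
      · exact ⟨Or.inl hx, hn, fun h => disjoint_left.1 hdisj hx (hA₂ h)⟩
      · exact ⟨Or.inr hx, fun h => disjoint_left.1 hdisj (hA₁ h) hx, hn⟩
  rw [hset, blockProd_union I (hW₁.sdiff h₁.isPolymer_cvSupp) (hW₂.sdiff h₂.isPolymer_cvSupp)
    (disjoint_of_subset_left sdiff_subset (disjoint_of_subset_right sdiff_subset hdisj))]
  simp only [cvTerm, cvMerge, Finset.prod_union hdS, Finset.prod_union hd𝒱]
  ring

/-- **`K_out` is multiplicative over non-touching pieces**: `K_out(W₁ ∪ W₂) = K_out(W₁) K_out(W₂)`.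
[cite: BrydgesSlade2015RGV, Appendix §11 ("K_out obeys the factorisation property of Definition 1.7 by construction")] -/
theorem kout_union (hW₁ : IsPolymer b W₁) (hW₂ : IsPolymer b W₂) :
    kout b I K J (W₁ ∪ W₂) = kout b I K J W₁ * kout b I K J W₂ := by
  classical
  have h21 : ¬ Touch W₂ W₁ := fun h => h12 h.symm
  unfold kout
  rw [Finset.sum_mul_sum, ← Finset.sum_product']
  symm
  refine Finset.sum_nbij' (fun qq => cvMerge qq.1 qq.2) (fun q => (cvRestrict W₁ q, cvRestrict W₂ q)) ?_ ?_ ?_ ?_ ?_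
  · rintro ⟨q₁, q₂⟩ hqq
    rw [mem_product] at hqq
    exact cvMerge_mem_cvFiber h12 hqq.1 hqq.2
  · intro q hq
    rw [mem_product]
    refine ⟨cvRestrict_mem_cvFiber h12 hq, cvRestrict_mem_cvFiber h21 ?_⟩
    rwa [union_comm]
  · rintro ⟨q₁, q₂⟩ hqq
    rw [mem_product] at hqq
    exact Prod.ext (cvRestrict_cvMerge_left h12 hqq.1 hqq.2) (cvRestrict_cvMerge_right h12 hqq.1 hqq.2)
  · intro q hq
    exact cvMerge_cvRestrict h12 hq
  · rintro ⟨q₁, q₂⟩ hqq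
    rw [mem_product] at hqq
    exact (cvTerm_mul_blockProd_cvMerge I K J h12 hW₁ hW₂ hqq.1 hqq.2).symm

end Split

/-- A member of a gas does not touch the union of the other members. [folklore] -/
theorem IsGas.not_touch_biUnion {G : Finset (Finset (TorusSite d M))} {Z : Finset (TorusSite d M)}
    (hG : IsGas b (insert Z G)) (hZ : Z ∉ G) : ¬ Touch Z (G.biUnion id) := by
  classical
  intro h
  obtain ⟨Y, hY, hZY⟩ := touch_biUnion_left.1 h.symm
  exact hG.2 Y (mem_insert_of_mem hY) Z (mem_insert_self _ _) (fun e => hZ (e ▸ hY)) hZY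

/-- **`K_out` over a gas**: `K_out(⋃𝒢) = ∏_{Z ∈ 𝒢} K_out(Z)`. [cite: BrydgesSlade2015RGV, Appendix §11 (factorisation property of K_out)] -/
theorem kout_biUnion_of_isGas {G : Finset (Finset (TorusSite d M))} (hG : IsGas b G) :
    kout b I K J (G.biUnion id) = ∏ Z ∈ G, kout b I K J Z := by
  classical
  induction G using Finset.induction_on with
  | empty => simp [kout_empty]
  | @insert Z G hZ ih =>
    have hG' : IsGas b G := hG.subset (subset_insert _ _)
    rw [Finset.biUnion_insert, Finset.prod_insert hZ, id, ← ih hG']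
    exact kout_union I K J (hG.not_touch_biUnion hZ) (hG.1 Z (mem_insert_self _ _)).1 hG'.isPolymer_biUnion

/-- **Component factorisation of `K_out`** (the factorisation property of `𝒦_j`, Slade Definition
6.1.2 / [BS-rg-step] Definition 1.7): `K_out(W) = ∏_{Z ∈ Comp(W)} K_out(Z)` for every polymer `W`.
[cite: BrydgesSlade2015RGV, Appendix §11 ("K_out obeys the factorisation property … by construction")] [cite: Slade2017, Definition 6.1.2] -/
theorem kout_eq_prod_components {W : Finset (TorusSite d M)} (hW : IsPolymer b W) :
    kout b I K J W = ∏ Z ∈ components W, kout b I K J Z := by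
  classical
  rw [← kout_biUnion_of_isGas I K J (isGas_components hW), biUnion_components_id]

/-! ### Field locality of `K_out` (values in the function algebra `𝒩`) -/

section Locality

variable {V S : Type*} [CommRing S]

omit [NeZero M] in
/-- `𝒩(X)` is closed under the ring product of `𝒩`. [folklore] -/
theorem DependsOn.mul' {X : Finset (TorusSite d M)} {F G : (TorusSite d M → V) → S} (hF : DependsOn X F)
    (hG : DependsOn X G) : DependsOn X (F * G) :=
  fun φ ψ h => by simp only [Pi.mul_apply, hF φ ψ h, hG φ ψ h]

omit [NeZero M] in
/-- `𝒩(X)` is closed under subtraction. [folklore] -/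
theorem DependsOn.sub' {X : Finset (TorusSite d M)} {F G : (TorusSite d M → V) → S} (hF : DependsOn X F)
    (hG : DependsOn X G) : DependsOn X (F - G) :=
  fun φ ψ h => by simp only [Pi.sub_apply, hF φ ψ h, hG φ ψ h]

omit [NeZero M] in
/-- `𝒩(X)` is closed under finite ring products. [folklore] -/
theorem DependsOn.prod' {β : Type*} {s : Finset β} {X : Finset (TorusSite d M)} {F : β → (TorusSite d M → V) → S}
    (h : ∀ k ∈ s, DependsOn X (F k)) : DependsOn X (∏ k ∈ s, F k) :=
  fun φ ψ hφψ => by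
    simp only [Finset.prod_apply]
    exact Finset.prod_congr rfl fun k hk => h k hk φ ψ hφψ

omit [NeZero M] in
/-- `𝒩(X)` is closed under finite sums. [folklore] -/
theorem DependsOn.sum' {β : Type*} {s : Finset β} {X : Finset (TorusSite d M)} {F : β → (TorusSite d M → V) → S}
    (h : ∀ k ∈ s, DependsOn X (F k)) : DependsOn X (∑ k ∈ s, F k) :=
  fun φ ψ hφψ => by
    simp only [Finset.sum_apply]
    exact Finset.sum_congr rfl fun k hk => h k hk φ ψ hφψ

/-- `I^X ∈ 𝒩(Y)` when every `I(B) ∈ 𝒩(Y)`, `B ∈ ℬ(X)`. [folklore] -/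
theorem dependsOn_blockProd {I : Finset (TorusSite d M) → (TorusSite d M → V) → S} {X Y : Finset (TorusSite d M)}
    (h : ∀ B ∈ blocksOf b X, DependsOn Y (I B)) : DependsOn Y (blockProd b I X) :=
  DependsOn.prod' h

/-- `I^X ∈ 𝒩(Z^□)` for a polymer `X ⊆ Z` when `I(B) ∈ 𝒩(B^□)` for all blocks. [folklore] -/
theorem dependsOn_blockProd_sclosure {I : Finset (TorusSite d M) → (TorusSite d M → V) → S}
    (hI : ∀ x : TorusSite d M, DependsOn (sclosure b (block b x)) (I (block b x))) {X Z : Finset (TorusSite d M)}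
    (hX : IsPolymer b X) (hXZ : X ⊆ Z) : DependsOn (sclosure b Z) (blockProd b I X) := by
  refine dependsOn_blockProd fun B hB => ?_
  obtain ⟨x, hx, rfl⟩ := exists_eq_block_of_mem_blocksOf hB
  exact (hI x).mono (sclosure_mono b ((hX hx).trans hXZ))

/-- **Field locality of `K_out`**: if `I(B) ∈ 𝒩(B^□)`, `J(U,B) ∈ 𝒩(B^□)` ("`J(U,B)` obeys the field
locality (in its `B` argument)") and `K_in(V) ∈ 𝒩(V^□)` for connected polymers `V`, then
`K_out(W) ∈ 𝒩(W^□)` for every polymer `W` ("the field locality property holds because we have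
constructed `K_out(W)` as a polynomial in the local objects `J̄, M, I_in` evaluated on sets contained
in `W`"). [cite: BrydgesSlade2015RGV, (4.3) and Appendix §11 (paragraph after (e:Kdef-new-ex))] -/
theorem dependsOn_kout {I : Finset (TorusSite d M) → (TorusSite d M → V) → S}
    {K : Finset (TorusSite d M) → (TorusSite d M → V) → S}
    {J : Finset (TorusSite d M) → Finset (TorusSite d M) → (TorusSite d M → V) → S}
    (hI : ∀ x : TorusSite d M, DependsOn (sclosure b (block b x)) (I (block b x)))
    (hJ0 : ∀ U B, J U B ≠ 0 → IsSmall b U ∧ B ∈ blocksOf b U)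
    (hJ : ∀ p ∈ djSet b, DependsOn (sclosure b p.2) (J p.1 p.2))
    (hK : ∀ Y : Finset (TorusSite d M), IsPolymer b Y → IsConn Y → DependsOn (sclosure b Y) (K Y))
    {W : Finset (TorusSite d M)} (hW : IsPolymer b W) : DependsOn (sclosure b W) (kout b I K J W) := by
  classical
  unfold kout
  refine DependsOn.sum' fun q hq => ?_
  obtain ⟨hadm, hWq⟩ := mem_cvFiber.1 hq
  rcases q with ⟨T, 𝒱⟩
  have hTW : ∀ p ∈ T, p.1 ⊆ W := fun p hp => hWq ▸ hadm.fst_subset_cvW hp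
  have h𝒱W : ∀ Y ∈ 𝒱, Y ⊆ W := fun Y hY => hWq ▸ hadm.subset_cvW_of_mem hY
  refine DependsOn.mul' (DependsOn.mul' (DependsOn.prod' fun p hp => ?_) (DependsOn.prod' fun Y hY => ?_)) ?_
  · -- `J̄(U, B) = I^U J(U,B)`
    have hp' := hadm.1 hp
    refine DependsOn.mul' (dependsOn_blockProd_sclosure hI (isPolymer_isConn_of_mem_djSet hp').1 (hTW p hp)) ?_
    refine (hJ p hp').mono (sclosure_mono b ?_)
    exact (subset_of_mem_blocksOf (mem_djSet.1 hp').1.1 (mem_djSet.1 hp').2).trans (hTW p hp)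
  · -- `M(Y) = K(Y) - I^Y Σ_B J(Y, B)`
    obtain ⟨hYp, hYc⟩ := mem_connSet.1 (hadm.2.1 hY)
    refine DependsOn.sub' ((hK Y hYp hYc).mono (sclosure_mono b (h𝒱W Y hY))) ?_
    refine DependsOn.mul' (dependsOn_blockProd_sclosure hI hYp (h𝒱W Y hY)) (DependsOn.sum' fun B hB => ?_)
    by_cases hsmall : IsSmall b Y
    · refine (hJ (Y, B) (mem_djSet.2 ⟨hsmall, hB⟩)).mono (sclosure_mono b ?_)
      exact (subset_of_mem_blocksOf hYp hB).trans (h𝒱W Y hY)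
    · -- not small: `J(Y, B) = 0`
      have h0 : J Y B = 0 := by
        by_contra hne
        exact hsmall (hJ0 Y B hne).1
      rw [h0]
      exact fun _ _ _ => rfl
  · exact dependsOn_blockProd_sclosure hI (hW.sdiff hadm.isPolymer_cvSupp) sdiff_subset

end Locality

end ChangeOfVariablesFactorisation

end Polymer

end LongRangePhi4

end Literature.Barriers.CriticalPhenomena
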